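/-
Copyright (c) 2026. All rights reserved.
Released under Apache 2.0 license as described in the file LICENSE.
-/
import Summits.HodgeConjecture.HodgeConjecture.Theorems.K2LiuArchKTypeScalarContinuation   -- ★ asm FILE 8 p861990 (`kType_scalar_continuation`)
import Summits.HodgeConjecture.HodgeConjecture.Theorems.K2LiuArchIntertwiningContinuedHalf   -- ★ `differentiable_archScalarSection_neg_param`
import Summits.HodgeConjecture.HodgeConjecture.Theorems.K2LiuU22KTypeSpanning                -- ★ S2-K `mem_iSup_kType` (every picture is a finite sum of K-types)
import HarnessLib

/-!
# Crux `HLiu418`, G6-arch ASSEMBLY FILE 9 — (E8) AT A COMPLEX PLACE, FINAL FORM: for EVERY compact picture `Q ∈ ℂ[u, D⁻¹]` and every `h ∈ U(J)`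
# there is `E` HOLOMORPHIC ON `{0 < re s}` with `M_w(s) F (h) = E(s)` for EVERY section `F ∈ I_w(s, χ_k)` with `cp F = Q`, at EVERY `s` with `re s > ½` (odd `k`)

Cell `hodgecm-mathlib`, crux item hLiu418 = `stmt-HodgeConjecture-24832` (helper lane `--supports`, count-neutral).  This is the archimedean block letter `hA`
(`DifferentiableOn ℂ (A κ) {0 < re}`) of ★ `K2LiuBigCellContinuationOfFaces.exists_bigCell_continuation_cm_of_faces` (K2Liu-p13 (g4)) at ONE complex place, in the
`U(J)` ∕ `archIntertwining` currency of the A∞ organ: `A κ s := E(s)` for `Q :=` the compact picture of the arch component of the standard section and `h := κ_∞`.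
PROOF: ★ S2-K `mem_iSup_kType` (every `Q` is a finite sum of `K_w`-type components) and `Submodule.iSup_induction` on the statement; on a `K_w`-type, ★ FILE 8
`kType_scalar_continuation` gives the holomorphic scalar `G_λ`, ★ asm FILE 1 puts `M_w F` in `I_w(−s,χ_k)` and ★ `apply_eq_archScalarSection_mul` reads its value at `h`
off its compact picture: `M_w(s)F(h) = G_λ(s) · f⁰_{−s,k}(h) · det(v_h)^k · ev_{v_h}(Q)` — holomorphic (★ `differentiable_archScalarSection_neg_param`); sums by ★ FILE 4
linearity (`integrable_bigCell`) and uniqueness on `U(J)` (★ `eq_of_apply_kU_eq`, ★ FILE 7 `archIntertwining_congr_UJ`).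
* **`kFinite_continuation (hk : Odd k) (Q : Carrier) (hh : h ∈ U(J)) : ∃ E, DifferentiableOn ℂ E {0<re} ∧ ∀ s, ½ < re s →
  (∃ F ∈ I_w(s,χ_k), cp F = Q) ∧ (∀ F ∈ I_w(s,χ_k), cp F = Q → M_w(s) F (h) = E s)`**.
What remains of (E8) after this file: the record-currency dictionary (the arch local integral of ★ Φ3d at `v ∣ ∞` ↔ `archIntertwining` on `U(J)`, one chart + one Haar
constant per complex place) and the product over the arch places — no analysis left.
References: [Shimura1982, (1.31)]; [LeeZhu1998, §5 Prop. 5.4]; [KudlaRallis1994, §1]; [Tan1999, §3].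
HONEST LABEL: HC_CM is proved only modulo the 7 printed citations (2 remaining named inputs: hLiu418 = stmt-HodgeConjecture-24832,
h413 = stmt-HodgeConjecture-24833) until rung 0 closes; count-neutral helper, closes no socket.
-/

set_option autoImplicit false
set_option linter.dupNamespace false

noncomputable section

open Complex Matrix MeasureTheory NormedSpace Filter
open scoped ComplexConjugate ComplexOrder Topology

namespace Summit.HodgeConjecture.HodgeConjecture.Cruxes.HLiu418.K2LiuArchKFiniteContinuation

open Literature.NumberTheory.ModularForms.SiegelUpperHalfSpace (denom)
open Summit.HodgeConjecture.HodgeConjecture.Cruxes.HLiu418.K2LiuArchInducedTubeDefs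
open Summit.HodgeConjecture.HodgeConjecture.Cruxes.HLiu418.K2LiuU22ShilovCoordinate (kU_mem_UJ)
open Summit.HodgeConjecture.HodgeConjecture.Cruxes.HLiu418.K2LiuU22CompactPictureDefs
open Summit.HodgeConjecture.HodgeConjecture.Cruxes.HLiu418.K2LiuU22KTypeSpanning (mem_iSup_kType)
open Summit.HodgeConjecture.HodgeConjecture.Cruxes.HLiu418.K2LiuArchSWOnePlaceRegion (eq_of_apply_kU_eq det_ne_zero_of_unitary isArchSiegelSection_add)
open Summit.HodgeConjecture.HodgeConjecture.Cruxes.HLiu418.K2LiuArchKFiniteSectionMajorised (apply_eq_archScalarSection_mul det_shilov_ne_zero)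
open Summit.HodgeConjecture.HodgeConjecture.Cruxes.HLiu418.K2LiuArchIntertwiningSiegelLaw (isArchSiegelSection_archIntertwining)
open Summit.HodgeConjecture.HodgeConjecture.Cruxes.HLiu418.K2LiuArchIntertwiningRightEquivariance (archIntertwining_add)
open Summit.HodgeConjecture.HodgeConjecture.Cruxes.HLiu418.K2LiuArchIntertwiningContinuedHalf (differentiable_archScalarSection_neg_param)
open Summit.HodgeConjecture.HodgeConjecture.Cruxes.HLiu418.K2LiuArchLadderPairTransport (integrable_bigCell)
open Summit.HodgeConjecture.HodgeConjecture.Cruxes.HLiu418.K2LiuArchKTypeRoutes (archIntertwining_congr_UJ)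
open Summit.HodgeConjecture.HodgeConjecture.Cruxes.HLiu418.K2LiuArchKTypeScalarContinuation (kType_scalar_continuation)

/-- **(E8) AT A COMPLEX PLACE, FINAL FORM** (odd `k`, any compact picture `Q`, any `h ∈ U(J)`): `∃ E` holomorphic on `{0 < re s}` such that at every `s` with `re s > ½`
a section `F ∈ I_w(s,χ_k)` with `cp F = Q` EXISTS and EVERY such section has `M_w(s) F (h) = E(s)`.  See the module docstring for the proof.
[Shimura1982, (1.31)] [LeeZhu1998, §5 Prop. 5.4] [KudlaRallis1994, §1] [Tan1999, §3] -/
theorem kFinite_continuation {k : ℤ} (hk : Odd k) (Q : Carrier) {h : Matrix (Fin 2 ⊕ Fin 2) (Fin 2 ⊕ Fin 2) ℂ} (hh : hᴴ * Matrix.J (Fin 2) ℂ * h = Matrix.J (Fin 2) ℂ) :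
    (∃ E : ℂ → ℂ, DifferentiableOn ℂ E {s : ℂ | 0 < s.re} ∧ ∀ s : ℂ, 1 / 2 < s.re →
        (∃ F : Matrix (Fin 2 ⊕ Fin 2) (Fin 2 ⊕ Fin 2) ℂ → ℂ, IsArchSiegelSection (fun z : ℂ => (conj z / ((‖z‖ : ℝ) : ℂ)) ^ k) s F ∧
          (∀ (v : Matrix (Fin 2) (Fin 2) ℂ), vᴴ * v = 1 → ∀ hv : v.det ≠ 0, F ((2 : ℂ)⁻¹ • fromBlocks (1 + v) (-(I • (1 - v))) (I • (1 - v)) (1 + v) : Matrix (Fin 2 ⊕ Fin 2) (Fin 2 ⊕ Fin 2) ℂ) = evalAt v hv Q)) ∧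
        (∀ F : Matrix (Fin 2 ⊕ Fin 2) (Fin 2 ⊕ Fin 2) ℂ → ℂ, IsArchSiegelSection (fun z : ℂ => (conj z / ((‖z‖ : ℝ) : ℂ)) ^ k) s F →
          (∀ (v : Matrix (Fin 2) (Fin 2) ℂ), vᴴ * v = 1 → ∀ hv : v.det ≠ 0, F ((2 : ℂ)⁻¹ • fromBlocks (1 + v) (-(I • (1 - v))) (I • (1 - v)) (1 + v) : Matrix (Fin 2 ⊕ Fin 2) (Fin 2 ⊕ Fin 2) ℂ) = evalAt v hv Q) → archIntertwining F h = E s)) := by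
  refine Submodule.iSup_induction (fun kl : ℕ × ℤ => kType kl.1 kl.2)
    (motive := fun Q : Carrier => (∃ E : ℂ → ℂ, DifferentiableOn ℂ E {s : ℂ | 0 < s.re} ∧ ∀ s : ℂ, 1 / 2 < s.re →
        (∃ F : Matrix (Fin 2 ⊕ Fin 2) (Fin 2 ⊕ Fin 2) ℂ → ℂ, IsArchSiegelSection (fun z : ℂ => (conj z / ((‖z‖ : ℝ) : ℂ)) ^ k) s F ∧
          (∀ (v : Matrix (Fin 2) (Fin 2) ℂ), vᴴ * v = 1 → ∀ hv : v.det ≠ 0, F ((2 : ℂ)⁻¹ • fromBlocks (1 + v) (-(I • (1 - v))) (I • (1 - v)) (1 + v) : Matrix (Fin 2 ⊕ Fin 2) (Fin 2 ⊕ Fin 2) ℂ) = evalAt v hv Q)) ∧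
        (∀ F : Matrix (Fin 2 ⊕ Fin 2) (Fin 2 ⊕ Fin 2) ℂ → ℂ, IsArchSiegelSection (fun z : ℂ => (conj z / ((‖z‖ : ℝ) : ℂ)) ^ k) s F →
          (∀ (v : Matrix (Fin 2) (Fin 2) ℂ), vᴴ * v = 1 → ∀ hv : v.det ≠ 0, F ((2 : ℂ)⁻¹ • fromBlocks (1 + v) (-(I • (1 - v))) (I • (1 - v)) (1 + v) : Matrix (Fin 2 ⊕ Fin 2) (Fin 2 ⊕ Fin 2) ℂ) = evalAt v hv Q) → archIntertwining F h = E s))) (mem_iSup_kType Q) ?_ ?_ ?_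
  · -- one `K_w`-type
    intro kl Q hQ
    obtain ⟨G, hGd, -, hG⟩ := kType_scalar_continuation hk kl.1 kl.2
    refine ⟨fun s => G s * (archScalarSection k (-s) h * (((denom h (-(I • (1 : Matrix (Fin 2) (Fin 2) ℂ))))⁻¹ * denom h (I • (1 : Matrix (Fin 2) (Fin 2) ℂ))).det ^ k *
      evalAt ((denom h (-(I • (1 : Matrix (Fin 2) (Fin 2) ℂ))))⁻¹ * denom h (I • (1 : Matrix (Fin 2) (Fin 2) ℂ))) (det_shilov_ne_zero hh) Q)), hGd.mul ((differentiable_archScalarSection_neg_param k hh).differentiableOn.mul (differentiableOn_const _)),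
      fun s hs => ?_⟩
    obtain ⟨⟨F, hF, hFQ, -⟩, huniq⟩ := hG s hs Q hQ
    refine ⟨⟨F, hF, hFQ⟩, fun F' hF' hF'Q => ?_⟩
    have hM := apply_eq_archScalarSection_mul k (-s) (isArchSiegelSection_archIntertwining k s hF') (G s • Q) (huniq F' hF' hF'Q) hh
    beta_reduce at hM
    rw [hM, map_smul, smul_eq_mul]
    ring
  · -- zero
    refine ⟨fun _ => 0, differentiableOn_const _, fun s hs => ⟨⟨fun _ => 0, fun p g _ _ => by simp, fun v hv hv' => by simp⟩, fun F' hF' hF'Q => ?_⟩⟩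
    have hzero : IsArchSiegelSection (fun z : ℂ => (conj z / ((‖z‖ : ℝ) : ℂ)) ^ k) s (fun _ : Matrix (Fin 2 ⊕ Fin 2) (Fin 2 ⊕ Fin 2) ℂ => (0 : ℂ)) := fun p g _ _ => by simp
    rw [archIntertwining_congr_UJ (fun g hg => eq_of_apply_kU_eq hF' hzero (fun v hv => by
      rw [hF'Q v hv (det_ne_zero_of_unitary hv), map_zero]) hg) hh]
    simp [archIntertwining_apply]
  · -- additivity
    rintro Q₁ Q₂ ⟨E₁, hE₁, h₁⟩ ⟨E₂, hE₂, h₂⟩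
    refine ⟨fun s => E₁ s + E₂ s, hE₁.add hE₂, fun s hs => ?_⟩
    obtain ⟨⟨F₁, hF₁, hF₁Q⟩, hu₁⟩ := h₁ s hs
    obtain ⟨⟨F₂, hF₂, hF₂Q⟩, hu₂⟩ := h₂ s hs
    refine ⟨⟨fun y => F₁ y + F₂ y, isArchSiegelSection_add hF₁ hF₂, fun v hv hv' => by beta_reduce; rw [hF₁Q v hv hv', hF₂Q v hv hv', map_add]⟩,
      fun F' hF' hF'Q => ?_⟩
    rw [archIntertwining_congr_UJ (fun g hg => eq_of_apply_kU_eq hF' (isArchSiegelSection_add hF₁ hF₂) (fun v hv => by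
      rw [hF'Q v hv (det_ne_zero_of_unitary hv), hF₁Q v hv (det_ne_zero_of_unitary hv), hF₂Q v hv (det_ne_zero_of_unitary hv), map_add]) hg) hh,
      archIntertwining_add (integrable_bigCell k hs hF₁ Q₁ hF₁Q hh) (integrable_bigCell k hs hF₂ Q₂ hF₂Q hh), hu₁ F₁ hF₁ hF₁Q, hu₂ F₂ hF₂ hF₂Q]

end Summit.HodgeConjecture.HodgeConjecture.Cruxes.HLiu418.K2LiuArchKFiniteContinuation

end
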